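import Summits.CriticalPhenomena.CardyFormulaZ2.Theorems.CardyMagicRigidityNestingRigidityNeckZ2VirtualEdges
import HarnessLib

/-!
# Crux `NestingRigidity`, line `pinch-resampling` (v4), stub S12: the covering lemma for `𝔄` on `ℤ²` (fuzzy chain, honest disconnection)

Crux `Summit.CriticalPhenomena.CardyFormulaZ2.Theses.CardyMagicRigidity.NestingRigidity`
(stmt-CriticalPhenomena-4835), line `pinch-resampling` v4, stub S12 `stub_neckHookupCoarseZ2 : NeckHookupCoarseZ2`.
`ℤ²` port of `covering_A` of the S11 road map (`…NestingRigidityNeckCoveringA`, worker S11), on top of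
`…NeckZ2VirtualEdges`: the deterministic, multi-scale core of the estimate of the error part
`𝔄 = Sel ∩ ZHookStar ∖ ZHookR` (a FUZZY chain joins the two open crossing clusters, which are honestly NOT joined
inside `Λ_{2s}(x)`).

**`NeckCoarseZ2.zCovering_A` (general node form).**  Given two open crossings `b, b'` of the collar, not joined by
an open path of `Λ_{2s}(x)`, but joined by a chain of real open edges of `Λ_{2s}(x)` and virtual edges (`zVEdges`:
same-`ℓ`-cell pairs of inner-layer vertices, the second in a big blob), there is a nonempty finite family `F` of
virtual edges — a MINIMAL re-connecting one — such that for EVERY nonempty sub-family `𝒩 ⊆ F` and every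
inner-layer centre `w` with the locales of `𝒩` inside `Λ_Δ(w)` and those of `F ∖ 𝒩` outside `Λ_{Γ-1}(w)`, every
square annulus `zAnn w r R` with `Δ + ℓ ≤ r ≤ R`, `R + ℓ ≤ Γ`, `R + 1 ≤ s` carries the tree's cluster-form four-arm
event `fourArmTwoClustersAt w r R` (two open crossings in DISTINCT open clusters of the annulus).  Proof
("D_in/D_out", as in S11): removing `𝒩` disconnects the chain (minimality); the real open classes of the two chain
ends inside the `𝒩`-free augmentation are distinct, each meets `Λ_{r-1}(w)` (at an endpoint of an `𝒩`-edge) and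
reaches sup distance `≥ R` from `w` (through its crossing to the outer layer, or through an endpoint of a far virtual
edge), and an open connection between them inside the annulus would re-connect the chain without `𝒩`.  For
`𝒩 = F` the separation hypothesis is void: the `k = 1` skeleton (one four-arm event from `ℓ`-scale to `s`-scale
around the whole family).  The probabilistic summation over the single-linkage hierarchy of `F` (róad-map item 2)
consumes exactly these node events, whose probabilities are bounded in the tree by `QuadCrossing.fourArm_bound` and
`real_fourArmTwoClustersAt`, and are independent over disjoint annuli.
-/

noncomputable section

namespace Summit.CriticalPhenomena.CardyFormulaZ2.Cruxes.NestingRigidity.PinchResampling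

open MeasureTheory Set Literature.Probability.Percolation Literature.Probability.LatticeModels
open ZPinchLocality

namespace NeckCoarseZ2

variable {ℓ lam s : ℕ} {x o : Site 2} {ω : BondConfig (Site 2)}

/-- **Covering lemma for `𝔄` on `ℤ²` (general node form; deterministic).**  See the module docstring. -/
theorem zCovering_A (hHG : ∀ a b, (openGraph ω).Adj a b → (zdGraph 2).Adj a b) (hℓ : 1 ≤ ℓ) {b b' : Site 2}
    (hb : IsCrossing (zdGraph 2) (openGraph ω) (zBall x s) (zBall x (2 * s)) b)
    (hb' : IsCrossing (zdGraph 2) (openGraph ω) (zBall x s) (zBall x (2 * s)) b')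
    (hnR : ¬ PathIn (openGraph ω) (zBall x (2 * s)) b b')
    (hchain : Relation.ReflTransGen (fun a c ↦ (a, c) ∈ zAugSteps s x ω (zVEdges ℓ lam s x o ω)) b b') :
    ∃ F : Finset (Site 2 × Site 2), ↑F ⊆ zVEdges ℓ lam s x o ω ∧ F.Nonempty ∧
      ∀ 𝒩 ⊆ F, 𝒩.Nonempty → ∀ (w : Site 2) (Δ r R Γ : ℕ),
        w ∈ innerLayer (zdGraph 2) (zBall x s) (zBall x (2 * s)) →
        (∀ e ∈ 𝒩, zNorm (e.2 - w) ≤ Δ) → (∀ e ∈ F, e ∉ 𝒩 → (Γ : ℤ) ≤ zNorm (e.2 - w)) →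
        Δ + ℓ ≤ r → r ≤ R → R + ℓ ≤ Γ → R + 1 ≤ s → ω ∈ fourArmTwoClustersAt w r R := by
  classical
  set O := zBall x (2 * s) with hO
  set H := openGraph ω with hH
  -- the finite universe of virtual edges and a minimal re-connecting family
  set U : Finset (Site 2 × Site 2) := (zVEdges_finite ℓ lam s x o ω).toFinset with hU
  let chain : Finset (Site 2 × Site 2) → Prop := fun F ↦
    Relation.ReflTransGen (fun a c ↦ (a, c) ∈ zAugSteps s x ω ↑F) b b'
  set 𝒞 := U.powerset.filter chain with h𝒞
  have hU𝒞 : U ∈ 𝒞 := by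
    refine Finset.mem_filter.2 ⟨Finset.mem_powerset.2 subset_rfl, ?_⟩
    simpa [chain, hU] using hchain
  obtain ⟨F, hF𝒞, hFmin⟩ := Finset.exists_min_image 𝒞 Finset.card ⟨U, hU𝒞⟩
  obtain ⟨hFU, hFchain⟩ := Finset.mem_filter.1 hF𝒞
  have hFU' : (↑F : Set (Site 2 × Site 2)) ⊆ zVEdges ℓ lam s x o ω := fun e he ↦ by
    have := Finset.mem_powerset.1 hFU he
    simpa [hU] using this
  have hbO : b ∈ O := hb.1.1.1
  -- minimality: no nonempty sub-family can be removed
  have hmin : ∀ 𝒩 ⊆ F, 𝒩.Nonempty →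
      ¬ Relation.ReflTransGen (fun a c ↦ (a, c) ∈ zAugSteps s x ω ↑(F \ 𝒩)) b b' := by
    intro 𝒩 h𝒩 hne hch
    have hmem : F \ 𝒩 ∈ 𝒞 :=
      Finset.mem_filter.2 ⟨Finset.mem_powerset.2 (Finset.sdiff_subset.trans (Finset.mem_powerset.1 hFU)), hch⟩
    have h1 := hFmin _ hmem
    have h2 : (F \ 𝒩).card < F.card := by
      obtain ⟨e, he⟩ := hne
      exact Finset.card_lt_card (Finset.sdiff_ssubset h𝒩 ⟨e, he⟩)
    omega
  refine ⟨F, hFU', ?_, ?_⟩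
  · -- `F` is nonempty: with no virtual edge the chain would be a real path
    by_contra hemp
    rw [Finset.not_nonempty_iff_eq_empty] at hemp
    rcases real_or_endpoint_of_zAugChain (G := (↑F : Set (Site 2 × Site 2)))
      (fun e he ↦ mem_zBall_of_mem_zVEdges (hFU' he)) hbO hFchain with h | ⟨e, he, -⟩
    · exact hnR h
    · simp [hemp] at he
  intro 𝒩 h𝒩 hne w Δ r R Γ hw hΔ hΓ hr hrR hRΓ hRs
  set G : Set (Site 2 × Site 2) := ↑(F \ 𝒩) with hG
  have hGF : G ⊆ ↑F := by intro e he; exact (Finset.mem_sdiff.1 (Finset.mem_coe.1 he)).1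
  have hGO : ∀ e ∈ G, e.1 ∈ O ∧ e.2 ∈ O := fun e he ↦ mem_zBall_of_mem_zVEdges (hFU' (hGF he))
  have hnG : ¬ Relation.ReflTransGen (fun a c ↦ (a, c) ∈ zAugSteps s x ω G) b b' := hmin 𝒩 h𝒩 hne
  have hsymm : ∀ (F' : Set (Site 2 × Site 2)) {a c : Site 2},
      Relation.ReflTransGen (fun a c ↦ (a, c) ∈ zAugSteps s x ω F') a c →
      Relation.ReflTransGen (fun a c ↦ (a, c) ∈ zAugSteps s x ω F') c a := by
    intro F' a c h
    exact zAugChain_symm h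
  -- the step of a full chain leaving a `G`-component is an `𝒩`-edge
  have hout : ∀ {c₀ c₁ : Site 2}, Relation.ReflTransGen (fun a c ↦ (a, c) ∈ zAugSteps s x ω ↑F) c₀ c₁ →
      ¬ Relation.ReflTransGen (fun a c ↦ (a, c) ∈ zAugSteps s x ω G) c₀ c₁ →
      ∃ y e, e ∈ 𝒩 ∧ (y = e.1 ∨ y = e.2) ∧ Relation.ReflTransGen (fun a c ↦ (a, c) ∈ zAugSteps s x ω G) c₀ y := by
    intro c₀ c₁ hch hn
    obtain ⟨y, z, hy, hz, hyz, -⟩ := zAugChain_exists_step_out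
      (P := {t | Relation.ReflTransGen (fun a c ↦ (a, c) ∈ zAugSteps s x ω G) c₀ t}) hch Relation.ReflTransGen.refl hn
    simp only [mem_setOf_eq] at hy hz
    rcases hyz with hreal | hF | hF
    · exact (hz (hy.tail (Or.inl hreal))).elim
    · by_cases hN : (y, z) ∈ 𝒩
      · exact ⟨y, (y, z), hN, Or.inl rfl, hy⟩
      · exact (hz (hy.tail (Or.inr (Or.inl (Finset.mem_coe.2 (Finset.mem_sdiff.2 ⟨Finset.mem_coe.1 hF, hN⟩)))))).elim
    · by_cases hN : (z, y) ∈ 𝒩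
      · exact ⟨y, (z, y), hN, Or.inr rfl, hy⟩
      · exact (hz (hy.tail (Or.inr (Or.inr (Finset.mem_coe.2 (Finset.mem_sdiff.2 ⟨Finset.mem_coe.1 hF, hN⟩)))))).elim
  obtain ⟨y, e₁, he₁, hy₁, hby⟩ := hout hFchain hnG
  obtain ⟨y', e₂, he₂, hy₂, hb'y'⟩ := hout (hsymm _ hFchain) fun h ↦ hnG (hsymm _ h)
  -- the two real classes are distinct
  have hnyy' : ¬ PathIn H O y y' := fun hp ↦
    hnG ((hby.trans (zAugChain_of_pathIn G Subset.rfl hp)).trans (hsymm _ hb'y'))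
  -- near: endpoints of `𝒩`-edges are inside `Λ_{r-1}(w)`
  have hnear : ∀ {y : Site 2} {e : Site 2 × Site 2}, e ∈ 𝒩 → (y = e.1 ∨ y = e.2) → zNorm (y - w) < r := by
    intro y e he hy
    have hΔe := hΔ e he
    have hev : e ∈ zVEdges ℓ lam s x o ω := hFU' (h𝒩 he)
    rcases hy with rfl | rfl
    · have h1 := zNorm_sub_lt_of_mem_zVEdges hℓ (show (e.1, e.2) ∈ zVEdges ℓ lam s x o ω from hev)
      have h2 := zNorm_sub_le_add e.1 e.2 w
      omega
    · omega
  -- far: each class reaches sup distance `≥ R` from `w`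
  have hfar : ∀ {c₀ y : Site 2}, IsCrossing (zdGraph 2) H (zBall x s) O c₀ →
      Relation.ReflTransGen (fun a c ↦ (a, c) ∈ zAugSteps s x ω G) c₀ y →
      ∃ q, PathIn H O y q ∧ (R : ℤ) ≤ zNorm (q - w) := by
    intro c₀ y hc₀ hch
    rcases real_or_endpoint_of_zAugChain hGO hc₀.1.1.1 hch with hp | ⟨e, he, hp | hp⟩
    · obtain ⟨-, q, hqo, hpq⟩ := hc₀
      refine ⟨q, (PathIn.symm hp).trans (hpq.mono Set.sdiff_subset), ?_⟩
      have h1 := zNorm_eq_of_mem_outerLayer hqo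
      have h2 := zNorm_eq_of_mem_innerLayer hw
      have h3 := zNorm_sub_le_add q w x
      omega
    · have heF : e ∈ F ∧ e ∉ 𝒩 := by simpa [hG] using he
      have hΓe := hΓ e heF.1 heF.2
      have hev : e ∈ zVEdges ℓ lam s x o ω := hFU' heF.1
      refine ⟨e.1, PathIn.symm hp, ?_⟩
      have h1 := zNorm_sub_lt_of_mem_zVEdges hℓ (show (e.1, e.2) ∈ zVEdges ℓ lam s x o ω from hev)
      have h2 := zNorm_sub_le_add e.2 e.1 w
      have h3 : zNorm (e.2 - e.1) = zNorm (e.1 - e.2) := zNorm_sub_comm _ _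
      omega
    · have heF : e ∈ F ∧ e ∉ 𝒩 := by simpa [hG] using he
      have hΓe := hΓ e heF.1 heF.2
      exact ⟨e.2, PathIn.symm hp, by omega⟩
  obtain ⟨q, hyq, hqR⟩ := hfar hb hby
  obtain ⟨q', hy'q', hq'R⟩ := hfar hb' hb'y'
  obtain ⟨p₁, q₁, hp₁, hq₁, hcross₁, hyp₁⟩ := exists_zAnn_crossing_of_pathIn hHG hrR (hnear he₁ hy₁) hqR hyq
  obtain ⟨p₂, q₂, hp₂, hq₂, hcross₂, hy'p₂⟩ := exists_zAnn_crossing_of_pathIn hHG hrR (hnear he₂ hy₂) hq'R hy'q'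
  refine mem_fourArmTwoClustersAt_of_crossings (by omega) hrR hp₁ hq₁ hp₂ hq₂ (hcross₁.mono inter_subset_right)
    (hcross₂.mono inter_subset_right) fun h12 ↦ hnyy' ?_
  exact hyp₁.trans ((h12.mono (zAnn_subset_zBall hw hRs)).trans (PathIn.symm hy'p₂))

/-! ## From a fuzzy hook-up to a step chain

The surrogate `ZHookStar` (`…NeckCoarseZ2Surrogate`) says: all big CROSSING footprints of the coarse datum are related by
the equivalence closure of "two footprints have inner-layer vertices, in cells of theirs, joined by a path of the link
graph through `Λ_s(x) ∪ innerLayer`".  Here the link graph is an arbitrary `Z ≤ openGraph ω` (for `ZHookStar` it is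
`zIntGraph x s ω`), so that this file does not depend on the surrogate module. -/

/-- The coarse footprint of the blob of a crossing vertex is a big crossing footprint of the coarse datum. -/
theorem footprint_mem_zCoarse_fst (hls : lam + 1 ≤ s) {v : Site 2}
    (hv : IsCrossing (zdGraph 2) (openGraph ω) (zBall x s) (zBall x (2 * s)) v) :
    cellOf ℓ o '' (blobOf (openGraph ω) (zBall x (2 * s) \ zBall x s) v ∩
        innerLayer (zdGraph 2) (zBall x s) (zBall x (2 * s))) ∈ (zCoarse ℓ lam s x o ω).1 :=
  ⟨v, hv.1, (big_and_crossing_of_isCrossing hls hv).1, (big_and_crossing_of_isCrossing hls hv).2, rfl⟩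

/-- A footprint of the coarse datum (crossing or dangling) is the footprint of the big blob of an inner-layer vertex. -/
theorem exists_rep_of_mem_zCoarse {A : Set (Site 2)} (hA : A ∈ (zCoarse ℓ lam s x o ω).1 ∪ (zCoarse ℓ lam s x o ω).2) :
    ∃ a₀ ∈ innerLayer (zdGraph 2) (zBall x s) (zBall x (2 * s)),
      (∃ w ∈ blobOf (openGraph ω) (zBall x (2 * s) \ zBall x s) a₀,
        ∃ w' ∈ blobOf (openGraph ω) (zBall x (2 * s) \ zBall x s) a₀, (lam : ℤ) ≤ zNorm (w - w')) ∧
      A = cellOf ℓ o '' (blobOf (openGraph ω) (zBall x (2 * s) \ zBall x s) a₀ ∩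
        innerLayer (zdGraph 2) (zBall x s) (zBall x (2 * s))) := by
  rcases hA with ⟨a₀, ha₀, hbig, -, hA⟩ | ⟨a₀, ha₀, hbig, -, hA⟩ <;> exact ⟨a₀, ha₀, hbig, hA⟩

/-- **Attachment**: an inner-layer vertex whose cell lies in the footprint of the big blob of `a₀` is virtually attached
to an inner-layer vertex of that blob. -/
theorem exists_zVEdge_of_cell_mem {a₀ u : Site 2}
    (hbig : ∃ w ∈ blobOf (openGraph ω) (zBall x (2 * s) \ zBall x s) a₀,
      ∃ w' ∈ blobOf (openGraph ω) (zBall x (2 * s) \ zBall x s) a₀, (lam : ℤ) ≤ zNorm (w - w'))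
    (hu : u ∈ innerLayer (zdGraph 2) (zBall x s) (zBall x (2 * s)))
    (hcell : cellOf ℓ o u ∈ cellOf ℓ o '' (blobOf (openGraph ω) (zBall x (2 * s) \ zBall x s) a₀ ∩
      innerLayer (zdGraph 2) (zBall x s) (zBall x (2 * s)))) :
    ∃ c ∈ blobOf (openGraph ω) (zBall x (2 * s) \ zBall x s) a₀, (u, c) ∈ zVEdges ℓ lam s x o ω := by
  obtain ⟨c, ⟨hc, hcL⟩, hcu⟩ := hcell
  refine ⟨c, hc, hu, hcL, hcu.symm, ?_⟩
  change ∃ w ∈ blobOf (openGraph ω) (zBall x (2 * s) \ zBall x s) c,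
    ∃ w' ∈ blobOf (openGraph ω) (zBall x (2 * s) \ zBall x s) c, (lam : ℤ) ≤ zNorm (w - w')
  rw [NeckCoarse.blobOf_eq_of_mem hc]
  exact hbig

/-- **From a fuzzy hook-up to a step chain (refinement of `𝔄`, first step).**  If all big crossing footprints are
related by the equivalence closure of the fuzzy-link relation for a link graph `Z ≤ openGraph ω`, but two crossings are
NOT joined by an open path of `Λ_{2s}(x)`, then two crossings not so joined ARE joined by a chain of real open edges of
`Λ_{2s}(x)` and virtual edges — the hypotheses of `zCovering_A`. -/
theorem exists_stepChain_of_fuzzyHook (hls : lam + 1 ≤ s) {Z : SimpleGraph (Site 2)} (hZ : Z ≤ openGraph ω)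
    (hS : ∀ S ∈ (zCoarse ℓ lam s x o ω).1, ∀ T ∈ (zCoarse ℓ lam s x o ω).1,
      Relation.EqvGen (fun A B ↦ A ∈ (zCoarse ℓ lam s x o ω).1 ∪ (zCoarse ℓ lam s x o ω).2 ∧
        B ∈ (zCoarse ℓ lam s x o ω).1 ∪ (zCoarse ℓ lam s x o ω).2 ∧
        ∃ a ∈ innerLayer (zdGraph 2) (zBall x s) (zBall x (2 * s)),
          ∃ b ∈ innerLayer (zdGraph 2) (zBall x s) (zBall x (2 * s)), cellOf ℓ o a ∈ A ∧ cellOf ℓ o b ∈ B ∧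
            PathIn Z (zBall x s ∪ innerLayer (zdGraph 2) (zBall x s) (zBall x (2 * s))) a b) S T)
    (hnH : ω ∉ ZHookR x s) :
    ∃ b b', IsCrossing (zdGraph 2) (openGraph ω) (zBall x s) (zBall x (2 * s)) b ∧
      IsCrossing (zdGraph 2) (openGraph ω) (zBall x s) (zBall x (2 * s)) b' ∧
      ¬ PathIn (openGraph ω) (zBall x (2 * s)) b b' ∧
      Relation.ReflTransGen (fun a c ↦ (a, c) ∈ zAugSteps s x ω (zVEdges ℓ lam s x o ω)) b b' := by
  set K := zBall x s with hK
  set O := zBall x (2 * s) with hO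
  set H := openGraph ω with hH
  set IL := innerLayer (zdGraph 2) K O with hIL
  set supp := (zCoarse ℓ lam s x o ω).1 ∪ (zCoarse ℓ lam s x o ω).2 with hsupp
  -- two crossings not hooked up
  have hvw : ∃ v w, IsCrossing (zdGraph 2) H K O v ∧ IsCrossing (zdGraph 2) H K O w ∧ ¬ PathIn H O v w := by
    by_contra hcon
    push Not at hcon
    exact hnH fun v w hv hw ↦ hcon v w hv hw
  obtain ⟨v, w, hv, hw, hnvw⟩ := hvw
  -- chains
  let Ch : Site 2 → Site 2 → Prop := fun a c ↦
    Relation.ReflTransGen (fun a c ↦ (a, c) ∈ zAugSteps s x ω (zVEdges ℓ lam s x o ω)) a c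
  have hKO : K ⊆ O := fun z hz ↦ by
    change zNorm (z - x) ≤ (2 * s : ℕ); have hz' : zNorm (z - x) ≤ s := hz; push_cast; omega
  have chain_symm' : ∀ {a c}, Ch a c → Ch c a := fun h ↦ zAugChain_symm h
  have chain_blob : ∀ {a₀ c c' : Site 2}, c ∈ blobOf H (O \ K) a₀ → c' ∈ blobOf H (O \ K) a₀ → Ch c c' :=
    fun hc hc' ↦ zAugChain_of_pathIn _ Set.sdiff_subset ((PathIn.symm hc).trans hc')
  have chain_vedge : ∀ {u c : Site 2}, (u, c) ∈ zVEdges ℓ lam s x o ω → Ch u c :=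
    fun h ↦ Relation.ReflTransGen.single (Or.inr (Or.inl h))
  have chain_link : ∀ {a b : Site 2}, PathIn Z (K ∪ IL) a b → Ch a b := fun hp ↦
    zAugChain_of_pathIn _ (union_subset hKO fun z hz ↦ hz.1.1) (hp.mono_graph hZ)
  -- the induction over the equivalence closure
  have key : ∀ A B, Relation.EqvGen (fun A B ↦ A ∈ supp ∧ B ∈ supp ∧ ∃ a ∈ IL, ∃ b ∈ IL,
        cellOf ℓ o a ∈ A ∧ cellOf ℓ o b ∈ B ∧ PathIn Z (K ∪ IL) a b) A B →
      A = B ∨ (A ∈ supp ∧ B ∈ supp ∧ ∀ u u', u ∈ IL → u' ∈ IL → cellOf ℓ o u ∈ A → cellOf ℓ o u' ∈ B → Ch u u') := by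
    intro A B h
    induction h with
    | rel A B hAB =>
      obtain ⟨hA, hB, a, haL, b, hbL, haA, hbB, hab⟩ := hAB
      refine Or.inr ⟨hA, hB, fun u u' hu hu' huA hu'B ↦ ?_⟩
      obtain ⟨a₀, -, hbigA, rfl⟩ := exists_rep_of_mem_zCoarse hA
      obtain ⟨b₀, -, hbigB, rfl⟩ := exists_rep_of_mem_zCoarse hB
      -- `u → c → (inside blob a₀) → c' → a → (link) → b → c₃ → (inside blob b₀) → c₄ → u'`
      obtain ⟨c, hc, he⟩ := exists_zVEdge_of_cell_mem hbigA hu huA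
      obtain ⟨c', hc', he'⟩ := exists_zVEdge_of_cell_mem hbigA haL haA
      obtain ⟨c₃, hc₃, he₃⟩ := exists_zVEdge_of_cell_mem hbigB hbL hbB
      obtain ⟨c₄, hc₄, he₄⟩ := exists_zVEdge_of_cell_mem hbigB hu' hu'B
      exact (((((chain_vedge he).trans (chain_blob hc hc')).trans (chain_symm' (chain_vedge he'))).trans
        (chain_link hab)).trans ((chain_vedge he₃).trans (chain_blob hc₃ hc₄))).trans (chain_symm' (chain_vedge he₄))
    | refl A => exact Or.inl rfl
    | symm A B _ ih =>
      rcases ih with rfl | ⟨hA, hB, h⟩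
      · exact Or.inl rfl
      · exact Or.inr ⟨hB, hA, fun u u' hu hu' huB hu'A ↦ chain_symm' (h u' u hu' hu hu'A huB)⟩
    | trans A B C _ _ ih₁ ih₂ =>
      rcases ih₁ with rfl | ⟨hA, hB, h₁⟩
      · exact ih₂
      · rcases ih₂ with rfl | ⟨-, hC, h₂⟩
        · exact Or.inr ⟨hA, hB, h₁⟩
        · refine Or.inr ⟨hA, hC, fun u u' hu hu' huA hu'C ↦ ?_⟩
          obtain ⟨b₀, hb₀L, -, rfl⟩ := exists_rep_of_mem_zCoarse hB
          have hb₀ : cellOf ℓ o b₀ ∈ cellOf ℓ o '' (blobOf H (O \ K) b₀ ∩ IL) :=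
            mem_image_of_mem _ ⟨NeckCoarse.self_mem_blobOf hb₀L.1, hb₀L⟩
          exact (h₁ u b₀ hu hb₀L huA hb₀).trans (h₂ b₀ u' hb₀L hu' hb₀ hu'C)
  -- apply to the footprints of the two crossings
  have hvfp := footprint_mem_zCoarse_fst (ℓ := ℓ) (o := o) hls hv
  have hwfp := footprint_mem_zCoarse_fst (ℓ := ℓ) (o := o) hls hw
  have hvcell : cellOf ℓ o v ∈ cellOf ℓ o '' (blobOf H (O \ K) v ∩ IL) :=
    mem_image_of_mem _ ⟨NeckCoarse.self_mem_blobOf hv.1.1, hv.1⟩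
  have hwcell : cellOf ℓ o w ∈ cellOf ℓ o '' (blobOf H (O \ K) w ∩ IL) :=
    mem_image_of_mem _ ⟨NeckCoarse.self_mem_blobOf hw.1.1, hw.1⟩
  refine ⟨v, w, hv, hw, hnvw, ?_⟩
  rcases key _ _ (hS _ hvfp _ hwfp) with heq | ⟨-, -, h⟩
  · -- equal footprints: attach `v` to the blob of `w` directly
    obtain ⟨c, hc, he⟩ := exists_zVEdge_of_cell_mem (big_and_crossing_of_isCrossing hls hw).1 hv.1 (heq ▸ hvcell)
    exact (chain_vedge he).trans (chain_blob hc (NeckCoarse.self_mem_blobOf hw.1.1))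
  · exact h v w hv.1 hw.1 hvcell hwcell

end NeckCoarseZ2

/-- **Covering lemma for `𝔄` on `ℤ²`, node form (registered helper, anchor of this module on the crux item)**: see
`NeckCoarseZ2.zCovering_A` and the module docstring. -/
theorem zCovering_A_nodes : ∀ (ℓ lam s : ℕ) (x o : Site 2) (ω : BondConfig (Site 2)), (∀ a b, (openGraph ω).Adj a b → (zdGraph 2).Adj a b) → 1 ≤ ℓ → ∀ b b' : Site 2, IsCrossing (zdGraph 2) (openGraph ω) (zBall x s) (zBall x (2 * s)) b → IsCrossing (zdGraph 2) (openGraph ω) (zBall x s) (zBall x (2 * s)) b' → ¬ PathIn (openGraph ω) (zBall x (2 * s)) b b' → Relation.ReflTransGen (fun a c ↦ (a, c) ∈ NeckCoarseZ2.zAugSteps s x ω (NeckCoarseZ2.zVEdges ℓ lam s x o ω)) b b' → ∃ F : Finset (Site 2 × Site 2), ↑F ⊆ NeckCoarseZ2.zVEdges ℓ lam s x o ω ∧ F.Nonempty ∧ ∀ 𝒩 ⊆ F, 𝒩.Nonempty → ∀ (w : Site 2) (Δ r R Γ : ℕ), w ∈ innerLayer (zdGraph 2) (zBall x s) (zBall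 x (2 * s)) → (∀ e ∈ 𝒩, zNorm (e.2 - w) ≤ Δ) → (∀ e ∈ F, e ∉ 𝒩 → (Γ : ℤ) ≤ zNorm (e.2 - w)) → Δ + ℓ ≤ r → r ≤ R → R + ℓ ≤ Γ → R + 1 ≤ s → ω ∈ fourArmTwoClustersAt w r R :=
  fun _ _ _ _ _ _ hHG hℓ _ _ hb hb' hnR hchain ↦ NeckCoarseZ2.zCovering_A hHG hℓ hb hb' hnR hchain

end Summit.CriticalPhenomena.CardyFormulaZ2.Cruxes.NestingRigidity.PinchResampling

end
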